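import Mathlib
import Summits.KontsevichZagierPeriods.Zeta5Search.FamilyCellAAtlasNotMin
import Summits.KontsevichZagierPeriods.Zeta5Search.RecordCellAProof
import HarnessLib

/-!
# ζ(5) search — FAMILY CELL A is a THEOREM: `v_p(Cas₇(b)) ≥ −4` for `b = n·(3t+8; t+6,…,t)`, `(t+3)n < p < (t+4)n`, all `t ≥ 4`

Cell `pub-zeta5` (HONEST FRAMING: systematic search; no irrationality claim unless certified), P1 prover seat
generation 5.  The one-parameter CONSECUTIVE FAMILY through the Brown–Zudilin record (`t = 11`; NEAR-MISSES rows 2, 3 are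
`t = 12, 14`): census g11 observed (`STRUCTURE §15.8`, 103/103 instances, `t = 4..20`) that cell A is uniform in `t`, and
gen-2 g9 proved the class-structure lemma on paper for all `t ≥ 4` (REPORT-gen2-g9 §2.2).  This file is the verbatim
generalisation of `RecordCellAProof.lean` (`11n ↦ tn`, `41n ↦ (3t+8)n`): the digit packages (`RecordCellADigitsA/S`) are
statements about an arbitrary `b` in the polytope and are reused as they stand; only the atlas (`FamilyCellAAtlas*`) and the
bookkeeping below are new.  Final theorems: `familyCellA`, **`familyCellA_holds : CellAtlas.FamilyCellA`** (the record cell is the instance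
`t = 11`, `CellAtlas.recordCellA_of_family familyCellA_holds`; it is already the tree theorem `recordCellA_holds`).  Valuations
of rational numbers; nothing about irrationality.
-/

noncomputable section

open Finset

namespace Summit.KontsevichZagierPeriods.Zeta5Search.CellA

open Summit.KontsevichZagierPeriods.Zeta5Search.DualSeries (InBox)
open Summit.KontsevichZagierPeriods.Zeta5Search.WedgeDictionary (pfData coeffW coeffV)
open Summit.KontsevichZagierPeriods.Zeta5Search.CasoratianValuation (InPolytope shift casoratian)
open Summit.KontsevichZagierPeriods.Zeta5Search.ClusterValuation
open Summit.KontsevichZagierPeriods.Zeta5Search.PadicSeries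
open Summit.KontsevichZagierPeriods.Zeta5Search.BigPrime (shift_zero padicNorm_mul_le_one)
open Summit.KontsevichZagierPeriods.Zeta5Search.CellAtlas (bFam)

variable {p : ℕ} [hp : Fact p.Prime]

/-! ### §2 The two halves of `W` and `V` -/

/-- The minimal part of `W`: `W_M = Σ_{x ∈ Min} W_x`. -/
def WMF (t n p : ℕ) (b : ℕ → ℤ) : ℚ := ∑ x ∈ FMinAll t n p, classW b p x
/-- The rest of `W`. -/
def WRF (t n p : ℕ) (b : ℕ → ℤ) : ℚ := ∑ x ∈ range p \ FMinAll t n p, classW b p x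
/-- The minimal part of `V`. -/
def VMF (t n p : ℕ) (b : ℕ → ℤ) : ℚ := ∑ x ∈ FMinAll t n p, classV b p x
/-- The rest of `V`. -/
def VRF (t n p : ℕ) (b : ℕ → ℤ) : ℚ := ∑ x ∈ range p \ FMinAll t n p, classV b p x

omit hp in
/-- `W = W_M + W_R`. -/
theorem coeffW_splitF (t n : ℕ) {p : ℕ} (hp0 : 0 < p) (b : ℕ → ℤ) : coeffW b = WMF t n p b + WRF t n p b := by
  rw [coeffW_eq_sum_classW b hp0, WMF, WRF, ← sum_union disjoint_sdiff, union_sdiff_of_subset (fminAll_subset t n p)]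

omit hp in
/-- `V = V_M + V_R`. -/
theorem coeffV_splitF (t n : ℕ) {p : ℕ} (hp0 : 0 < p) (b : ℕ → ℤ) : coeffV b = VMF t n p b + VRF t n p b := by
  rw [coeffV_eq_sum_classV b hp0, VMF, VRF, ← sum_union disjoint_sdiff, union_sdiff_of_subset (fminAll_subset t n p)]

/-! ### §3 The minimal block: integrality and THE congruence, for any `b′` with the record class data -/

section MinBlock

variable {t n : ℕ} (hp14 : t * n + 3 * n < p) (hp15 : p < t * n + 4 * n) (hp5 : 5 ≤ p)
  (b : ℕ → ℤ) (hb : InPolytope b) (hwin : (b 0 + 2 : ℤ) < (p : ℤ) ^ 2) (hN : (b 0).toNat = (3 * (t * n) + 8 * n))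
  (hA : ∀ x ∈ FMinA t n p, netExp b x = -1 ∧ netExp b (x + p) = -3)
  (hS : ∀ x ∈ FMinS t n p, netExp b x = -2 ∧ netExp b (x + p) = -2)

include hp5 hb hwin hN hA in
/-- The digit package of a class of `MinA` (and of its conjugate in `MinAbar`). -/
theorem packFA {x : ℕ} (hx : x ∈ FMinA t n p) :
    padicNorm p ((p : ℚ) * classW b p x) ≤ 1 ∧ padicNorm p ((p : ℚ) ^ 4 * classV b p x) ≤ 1 ∧
    padicNorm p ((p : ℚ) * classW b p ((3 * (t * n) + 8 * n) - (x + p))) ≤ 1 ∧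
    padicNorm p ((p : ℚ) ^ 4 * classV b p ((3 * (t * n) + 8 * n) - (x + p))) ≤ 1 ∧
    padicNorm p (digitDefect b p x + digitDefect b p ((3 * (t * n) + 8 * n) - (x + p))) ≤ (p : ℚ) ^ (-(1 : ℤ)) := by
  have hx' := mem_fminA.1 hx
  obtain ⟨e0, e1⟩ := hA x hx
  have h := digitA_pair b hb hp5 hwin (q₀ := x) hx'.1 (by rw [hN]; omega) (by rw [hN]; omega) e0 e1
  rw [hN] at h
  exact h

include hp14 hp5 hb hwin hN hS in
/-- The digit package of a class of `MinS` (and of its conjugate, again in `MinS`). -/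
theorem packFS {x : ℕ} (hx : x ∈ FMinS t n p) :
    padicNorm p ((p : ℚ) * classW b p x) ≤ 1 ∧ padicNorm p ((p : ℚ) ^ 4 * classV b p x) ≤ 1 ∧
    padicNorm p ((p : ℚ) * classW b p ((3 * (t * n) + 8 * n) - (x + p))) ≤ 1 ∧
    padicNorm p ((p : ℚ) ^ 4 * classV b p ((3 * (t * n) + 8 * n) - (x + p))) ≤ 1 ∧
    padicNorm p (digitDefect b p x + digitDefect b p ((3 * (t * n) + 8 * n) - (x + p))) ≤ (p : ℚ) ^ (-(1 : ℤ)) := by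
  have hx' := mem_fminS.1 hx
  obtain ⟨e0, e1⟩ := hS x hx
  have h := digitS_pair b hb hp5 hwin (q₀ := x) hx'.1 (by rw [hN]; omega) (by rw [hN]; omega) e0 e1
  rw [hN] at h
  exact h

include hp14 in
omit hp in
/-- A sum over `MinAbar` is the sum over `MinA` of the conjugates. -/
theorem sum_fminAbar_eq (f : ℕ → ℚ) : ∑ x ∈ FMinAbar t n p, f x = ∑ x ∈ FMinA t n p, f ((3 * (t * n) + 8 * n) - (x + p)) := by
  refine (sum_nbij' (fun x => (3 * (t * n) + 8 * n) - (x + p)) (fun x => (3 * (t * n) + 8 * n) - (x + p)) (fun x hx => conj_mem_fminAbar hx)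
    (fun x hx => conj_mem_fminA hp14 hx) (fun x hx => ?_) (fun x hx => ?_) (fun x hx => rfl)).symm
  · have := mem_fminA.1 hx; omega
  · have := mem_fminAbar.1 hx; omega

include hp14 in
omit hp in
/-- A sum over `MinS` equals the sum of the conjugates. -/
theorem sum_fminS_conj (f : ℕ → ℚ) : ∑ x ∈ FMinS t n p, f ((3 * (t * n) + 8 * n) - (x + p)) = ∑ x ∈ FMinS t n p, f x :=
  sum_nbij' (fun x => (3 * (t * n) + 8 * n) - (x + p)) (fun x => (3 * (t * n) + 8 * n) - (x + p)) (fun x hx => conj_mem_fminS hp14 hx)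
    (fun x hx => conj_mem_fminS hp14 hx) (fun x hx => by have := mem_fminS.1 hx; omega)
    (fun x hx => by have := mem_fminS.1 hx; omega) (fun x hx => rfl)

include hp14 hp15 in
omit hp in
/-- Splitting a sum over `MinAll` into conjugate pairs of `MinA ∪ MinAbar` and the classes of `MinS`. -/
theorem sum_fminAll (f : ℕ → ℚ) :
    ∑ x ∈ FMinAll t n p, f x = ∑ x ∈ FMinA t n p, (f x + f ((3 * (t * n) + 8 * n) - (x + p))) + ∑ x ∈ FMinS t n p, f x := by
  rw [FMinAll, sum_union (disjoint_fminAS_fminAbar hp15), sum_union (disjoint_fminA_fminS t n p), sum_fminAbar_eq hp14,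
    sum_add_distrib]
  ring

include hp14 hp15 hp5 hb hwin hN hA hS in
/-- **`‖p·W_M‖ ≤ 1`.** -/
theorem padicNorm_WMF_le : padicNorm p ((p : ℚ) * WMF t n p b) ≤ 1 := by
  rw [WMF, mul_sum, sum_fminAll hp14 hp15]
  refine nI_add (padicNorm.sum_le' (fun x hx => ?_) zero_le_one) (padicNorm.sum_le' (fun x hx => ?_) zero_le_one)
  · obtain ⟨h1, -, h3, -, -⟩ := packFA hp5 b hb hwin hN hA hx
    exact nI_add h1 h3
  · exact (packFS hp14 hp5 b hb hwin hN hS hx).1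

include hp14 hp15 hp5 hb hwin hN hA hS in
/-- **`‖p⁴·V_M‖ ≤ 1`.** -/
theorem padicNorm_VMF_le : padicNorm p ((p : ℚ) ^ 4 * VMF t n p b) ≤ 1 := by
  rw [VMF, mul_sum, sum_fminAll hp14 hp15]
  refine nI_add (padicNorm.sum_le' (fun x hx => ?_) zero_le_one) (padicNorm.sum_le' (fun x hx => ?_) zero_le_one)
  · obtain ⟨-, h2, -, h4, -⟩ := packFA hp5 b hb hwin hN hA hx
    exact nI_add h2 h4
  · exact (packFS hp14 hp5 b hb hwin hN hS hx).2.1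

include hp14 hp15 hp5 hb hwin hN hA hS in
/-- **THE CONGRUENCE `p·W_M ≡ p⁴·V_M (mod p)`.** -/
theorem padicNorm_WMF_sub_VMF_le :
    padicNorm p ((p : ℚ) * WMF t n p b - (p : ℚ) ^ 4 * VMF t n p b) ≤ (p : ℚ) ^ (-(1 : ℤ)) := by
  have e : (p : ℚ) * WMF t n p b - (p : ℚ) ^ 4 * VMF t n p b = ∑ x ∈ FMinAll t n p, digitDefect b p x := by
    rw [WMF, VMF, mul_sum, mul_sum, ← sum_sub_distrib]; rfl
  rw [e, sum_fminAll hp14 hp15]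
  refine small_add (padicNorm.sum_le' (fun x hx => (packFA hp5 b hb hwin hN hA hx).2.2.2.2) (zpow_p_nonneg _)) ?_
  -- the `MinS` part: twice the sum is the sum over conjugate pairs
  have h2 : (2 : ℚ) * ∑ x ∈ FMinS t n p, digitDefect b p x =
      ∑ x ∈ FMinS t n p, (digitDefect b p x + digitDefect b p ((3 * (t * n) + 8 * n) - (x + p))) := by
    rw [sum_add_distrib, sum_fminS_conj hp14, two_mul]
  have hb2 : padicNorm p ((2 : ℚ) * ∑ x ∈ FMinS t n p, digitDefect b p x) ≤ (p : ℚ) ^ (-(1 : ℤ)) := by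
    rw [h2]
    exact padicNorm.sum_le' (fun x hx => (packFS hp14 hp5 b hb hwin hN hS hx).2.2.2.2) (zpow_p_nonneg _)
  have htwo : padicNorm p (2 : ℚ) = 1 := by
    have hp2 : p ≠ 2 := by omega
    have := (padicNorm.nat_eq_one_iff (p := p) 2).2 (by
      intro h
      exact hp2 ((Nat.prime_dvd_prime_iff_eq hp.out Nat.prime_two).1 h))
    exact_mod_cast this
  rw [padicNorm.mul, htwo, one_mul] at hb2
  exact hb2

end MinBlock

/-! ### §4 The rest: `‖W_R‖ ≤ 1`, `‖V_R‖ ≤ p³` for `b(n)` and `b(n) + e₇` -/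

section Rest

variable {t n : ℕ} (hn : 1 ≤ n) (ht : 4 ≤ t) (h4 : 4 * n ≤ t * n) (hp14 : t * n + 3 * n < p) (hp15 : p < t * n + 4 * n)
  (hp5 : 5 ≤ p)

include hn h4 hp14 in
omit hp in
/-- The window inequality `b₀ + 2 < p²` on the cell. -/
theorem window_bFam : (bFam t n 0 + 2 : ℤ) < (p : ℤ) ^ 2 := by
  rw [bFam_val0]
  have h1 : ((t * n + 3 * n : ℕ) : ℤ) < p := by exact_mod_cast hp14
  have h2 : ((4 * n : ℕ) : ℤ) ≤ ((t * n : ℕ) : ℤ) := by exact_mod_cast h4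
  have h3 : (1 : ℤ) ≤ n := by exact_mod_cast hn
  push_cast at h1 h2 ⊢
  nlinarith

include hn h4 hp14 hp15 in
/-- The hypotheses of §1 for the family on the non-minimal classes. -/
theorem rest_data_bFam {x : ℕ} (hx : x ∈ range p \ FMinAll t n p) :
    x < p ∧ (1 ≤ classPoleCount (bFam t n) p x → -3 ≤ classNu (bFam t n) p x) ∧
      (2 ≤ classPoleCount (bFam t n) p x → -3 ≤ classExp (bFam t n) p x) := by
  rw [mem_sdiff, mem_range, FMinAll, mem_union, mem_union, not_or, not_or] at hx
  obtain ⟨hxp, ⟨hA, hS⟩, hB⟩ := hx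
  have hodd : ¬ 2 ∣ p := fun h => by
    have := (Nat.prime_dvd_prime_iff_eq Nat.prime_two hp.out).1 h; omega
  have hν := classNu_ge_of_notFMin hn h4 hp14 hp15 hxp hodd hA hS hB
  refine ⟨hxp, fun _ => hν, fun h2 => ?_⟩
  have : classNu (bFam t n) p x = classExp (bFam t n) p x := by
    unfold classNu; rw [if_neg (by omega)]
  rw [← this]; exact hν

include hn ht h4 hp14 hp15 hp5 in
/-- **`‖W_R(b)‖ ≤ 1` and `‖V_R(b)‖ ≤ p³`** on the family. -/
theorem rest_bFam : padicNorm p (WRF t n p (bFam t n)) ≤ 1 ∧ padicNorm p (VRF t n p (bFam t n)) ≤ (p : ℚ) ^ (3 : ℤ) := by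
  have hb := inPolytope_bFam ht n
  have hwin := window_bFam (p := p) hn h4 hp14
  refine ⟨padicNorm.sum_le' (fun x hx => ?_) zero_le_one, padicNorm.sum_le' (fun x hx => ?_) (zpow_p_nonneg _)⟩
  · obtain ⟨-, -, hE⟩ := rest_data_bFam hn h4 hp14 hp15 hx
    exact padicNorm_classW_le_one _ hb hp5 hwin hE
  · obtain ⟨hxp, hν, -⟩ := rest_data_bFam hn h4 hp14 hp15 hx
    exact padicNorm_classV_le_cube _ hb hp5 hwin hxp hν

include hn ht h4 hp14 hp15 hp5 in
/-- **`‖W_R(b+e₇)‖ ≤ 1` and `‖V_R(b+e₇)‖ ≤ p³`** on the family (shift monotonicity of the class data). -/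
theorem rest_shiftF : padicNorm p (WRF t n p (shift (bFam t n) 7)) ≤ 1 ∧
    padicNorm p (VRF t n p (shift (bFam t n) 7)) ≤ (p : ℚ) ^ (3 : ℤ) := by
  have hb := inPolytope_bFam ht n
  have hb' := inPolytope_shift_bFam ht hn
  have hwin := window_bFam (p := p) hn h4 hp14
  have hwin' : (shift (bFam t n) 7 0 + 2 : ℤ) < (p : ℤ) ^ 2 := by rw [shift_zero _ (by norm_num)]; exact hwin
  have hcnt : ∀ x, classPoleCount (shift (bFam t n) 7) p x ≤ classPoleCount (bFam t n) p x :=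
    fun x => classPoleCount_shift_le _ hb.1 (by norm_num) p x
  refine ⟨padicNorm.sum_le' (fun x hx => ?_) zero_le_one, padicNorm.sum_le' (fun x hx => ?_) (zpow_p_nonneg _)⟩
  · obtain ⟨-, -, hE⟩ := rest_data_bFam hn h4 hp14 hp15 hx
    refine padicNorm_classW_le_one _ hb' hp5 hwin' fun h2 => ?_
    exact (hE (h2.trans (hcnt x))).trans (classExp_shift_ge _ hb.1 (by norm_num) p x)
  · obtain ⟨hxp, hν, -⟩ := rest_data_bFam hn h4 hp14 hp15 hx
    refine padicNorm_classV_le_cube _ hb' hp5 hwin' hxp fun h1 => ?_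
    exact (hν (h1.trans (hcnt x))).trans (classNu_shift_ge _ hb.1 (by norm_num) h1)

end Rest

/-! ### §5 FAMILY CELL A -/

/-- **FAMILY CELL A (census g11) is a THEOREM.**  For `t ≥ 4`, `n ≥ 2` and every prime `(t+3)n < p < (t+4)n`:
`v_p(W(b⁺)V(b) − W(b)V(b⁺)) ≥ −4` for `b = n·(3t+8; t+6,…,t)`, `b⁺ = b + e₇` (the record is `t = 11`; NEAR-MISSES rows 2, 3 are
`t = 12, 14`; census g11: 103/103 instances, tree/THEOREM LB proved only `−5`).  Literally `CellAtlas.FamilyCellA`. -/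
theorem familyCellA : ∀ t n p : ℕ, 4 ≤ t → 2 ≤ n → p.Prime → (t + 3) * n < p → p < (t + 4) * n →
    casoratian (bFam t n) 7 ≠ 0 → (-4 : ℤ) ≤ padicValRat p (casoratian (bFam t n) 7) := by
  intro t n p ht hn2 hprime hp14' hp15' hne
  haveI : Fact p.Prime := ⟨hprime⟩
  have hn : 1 ≤ n := by omega
  have h4 : 4 * n ≤ t * n := Nat.mul_le_mul_right n ht
  have hp14 : t * n + 3 * n < p := by rw [← Nat.add_mul]; exact hp14'
  have hp15 : p < t * n + 4 * n := by rw [← Nat.add_mul]; exact hp15'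
  have hp5 : 5 ≤ p := by omega
  set b := bFam t n with hbdef
  set b' := shift (bFam t n) 7 with hb'def
  have hb : InPolytope b := inPolytope_bFam ht n
  have hb' : InPolytope b' := inPolytope_shift_bFam ht hn
  have hwin : (b 0 + 2 : ℤ) < (p : ℤ) ^ 2 := window_bFam hn h4 hp14
  have hwin' : (b' 0 + 2 : ℤ) < (p : ℤ) ^ 2 := by rw [hb'def, shift_zero _ (by norm_num)]; exact hwin
  have hN : (b 0).toNat = 3 * (t * n) + 8 * n := bFam_zero_toNat t n
  have hN' : (b' 0).toNat = 3 * (t * n) + 8 * n := shiftF7_zero_toNat t n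
  have hA : ∀ x ∈ FMinA t n p, netExp b x = -1 ∧ netExp b (x + p) = -3 := fun x hx =>
    let h := netExp_fminA ht hp14 hp15 hx; ⟨h.1, h.2.1⟩
  have hS : ∀ x ∈ FMinS t n p, netExp b x = -2 ∧ netExp b (x + p) = -2 := fun x hx =>
    let h := netExp_fminS ht hp14 hp15 hx; ⟨h.1, h.2.1⟩
  have hA' : ∀ x ∈ FMinA t n p, netExp b' x = -1 ∧ netExp b' (x + p) = -3 := fun x hx =>
    let h := netExp_fminA ht hp14 hp15 hx; ⟨h.2.2.1, h.2.2.2.1⟩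
  have hS' : ∀ x ∈ FMinS t n p, netExp b' x = -2 ∧ netExp b' (x + p) = -2 := fun x hx =>
    let h := netExp_fminS ht hp14 hp15 hx; ⟨h.2.2.1, h.2.2.2.1⟩
  -- the eight bounded quantities
  set A := (p : ℚ) * WMF t n p b with hAdef
  set A' := (p : ℚ) * WMF t n p b' with hA'def
  set B := (p : ℚ) ^ 4 * VMF t n p b with hBdef
  set B' := (p : ℚ) ^ 4 * VMF t n p b' with hB'def
  set C := (p : ℚ) ^ 3 * VRF t n p b with hCdef
  set C' := (p : ℚ) ^ 3 * VRF t n p b' with hC'def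
  set R := WRF t n p b with hRdef
  set R' := WRF t n p b' with hR'def
  have iA : padicNorm p A ≤ 1 := padicNorm_WMF_le hp14 hp15 hp5 b hb hwin hN hA hS
  have iA' : padicNorm p A' ≤ 1 := padicNorm_WMF_le hp14 hp15 hp5 b' hb' hwin' hN' hA' hS'
  have iB : padicNorm p B ≤ 1 := padicNorm_VMF_le hp14 hp15 hp5 b hb hwin hN hA hS
  have iB' : padicNorm p B' ≤ 1 := padicNorm_VMF_le hp14 hp15 hp5 b' hb' hwin' hN' hA' hS'
  have dAB : padicNorm p (A - B) ≤ (p : ℚ) ^ (-(1 : ℤ)) := padicNorm_WMF_sub_VMF_le hp14 hp15 hp5 b hb hwin hN hA hS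
  have dAB' : padicNorm p (A' - B') ≤ (p : ℚ) ^ (-(1 : ℤ)) :=
    padicNorm_WMF_sub_VMF_le hp14 hp15 hp5 b' hb' hwin' hN' hA' hS'
  obtain ⟨iR, iVR⟩ := rest_bFam (p := p) hn ht h4 hp14 hp15 hp5
  obtain ⟨iR', iVR'⟩ := rest_shiftF (p := p) hn ht h4 hp14 hp15 hp5
  have hp3 : padicNorm p ((p : ℚ) ^ 3) = ((p : ℚ) ^ 3)⁻¹ := padicNorm_p_pow 3
  have iC : padicNorm p C ≤ 1 := by
    rw [hCdef, padicNorm.mul, hp3]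
    calc ((p : ℚ) ^ 3)⁻¹ * padicNorm p (VRF t n p b) ≤ ((p : ℚ) ^ 3)⁻¹ * (p : ℚ) ^ (3 : ℤ) :=
          mul_le_mul_of_nonneg_left iVR (inv_nonneg.2 (pow_nonneg (Nat.cast_nonneg _) _))
      _ = 1 := by rw [zpow_ofNat, inv_mul_cancel₀ (pow_ne_zero _ (Nat.cast_ne_zero.2 hprime.ne_zero))]
  have iC' : padicNorm p C' ≤ 1 := by
    rw [hC'def, padicNorm.mul, hp3]
    calc ((p : ℚ) ^ 3)⁻¹ * padicNorm p (VRF t n p b') ≤ ((p : ℚ) ^ 3)⁻¹ * (p : ℚ) ^ (3 : ℤ) :=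
          mul_le_mul_of_nonneg_left iVR' (inv_nonneg.2 (pow_nonneg (Nat.cast_nonneg _) _))
      _ = 1 := by rw [zpow_ofNat, inv_mul_cancel₀ (pow_ne_zero _ (Nat.cast_ne_zero.2 hprime.ne_zero))]
  -- the identity
  have hp0 : (p : ℚ) ≠ 0 := Nat.cast_ne_zero.2 hprime.ne_zero
  have hW : coeffW b = A / p + R := by
    rw [coeffW_splitF t n hprime.pos b, hAdef, hRdef]; field_simp
  have hW' : coeffW b' = A' / p + R' := by
    rw [coeffW_splitF t n hprime.pos b', hA'def, hR'def]; field_simp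
  have hV : coeffV b = B / (p : ℚ) ^ 4 + C / (p : ℚ) ^ 3 := by
    rw [coeffV_splitF t n hprime.pos b, hBdef, hCdef]; field_simp
  have hV' : coeffV b' = B' / (p : ℚ) ^ 4 + C' / (p : ℚ) ^ 3 := by
    rw [coeffV_splitF t n hprime.pos b', hB'def, hC'def]; field_simp
  have e : (p : ℚ) ^ 5 * casoratian b 7 =
      (A' * (B - A) - A * (B' - A')) + p * (A' * C + R' * B - A * C' - R * B') + (p : ℚ) ^ 2 * (R' * C - R * C') := by
    rw [casoratian, ← hb'def, hW, hW', hV, hV']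
    field_simp
    ring
  -- the bound `‖p⁵·Cas‖ ≤ p⁻¹`
  have ip : padicNorm p (p : ℚ) ≤ 1 := nI_nat p
  have h5 : padicNorm p ((p : ℚ) ^ 5 * casoratian b 7) ≤ (p : ℚ) ^ (-(1 : ℤ)) := by
    rw [e]
    refine small_add (small_add (small_sub (small_mul iA' (by rw [← neg_sub, padicNorm.neg]; exact dAB))
      (small_mul iA (by rw [← neg_sub, padicNorm.neg]; exact dAB'))) (small_p_mul ?_)) ?_
    · exact nI_sub (nI_sub (nI_add (padicNorm_mul_le_one iA' iC) (padicNorm_mul_le_one iR' iB))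
        (padicNorm_mul_le_one iA iC')) (padicNorm_mul_le_one iR iB')
    · rw [pow_two, mul_assoc]
      exact small_mul ip (small_p_mul (nI_sub (padicNorm_mul_le_one iR' iC) (padicNorm_mul_le_one iR iC')))
  -- unscale
  apply val_ge_of_padicNorm_le hne
  have hp5n : padicNorm p ((p : ℚ) ^ 5) = ((p : ℚ) ^ 5)⁻¹ := padicNorm_p_pow 5
  have hpos : (0 : ℚ) < (p : ℚ) ^ 5 := pow_pos (by exact_mod_cast hprime.pos) 5
  rw [padicNorm.mul, hp5n, inv_mul_le_iff₀ hpos] at h5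
  refine h5.trans (le_of_eq ?_)
  rw [neg_neg, ← zpow_natCast, ← zpow_add₀ hp0]
  norm_num

/-- **`CellAtlas.FamilyCellA` (census g11) is a THEOREM** — discharged by name. -/
theorem familyCellA_holds : CellAtlas.FamilyCellA := familyCellA

end Summit.KontsevichZagierPeriods.Zeta5Search.CellA

end
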